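import Summits.Ventures.YMGap.RobustBall.DirectionalSusceptibilityS
import Summits.Ventures.YMGap.RobustBall.SourceGeometry
import Summits.Ventures.YMGap.Thresholds.ConnectedThreePointTools
import HarnessLib

/-!
# Venture YMGap, track ROBUST-BALL (Y2) — TIER 2: TREE DECAY OF THE THIRD CUMULANT OF ARBITRARY LOCAL OBSERVABLES, UNIFORMLY ON THE WEIGHTED BALL

HONEST FRAMING. WHAT THIS IS: a venture file (cell `pub-ymgap`, track Y2 ROBUST-BALL, seat rb-p1, theorems only): the BALL twin, for three ARBITRARY
bounded local Frobenius-Lipschitz observables `f, g, h` (supports `Δ_•`, vectors `δ_•`, bounds `M_•`), of ds-1's tree decay of the third cumulant of the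
Wilson state against plaquettes (`Thresholds/ConnectedThreePointDecay.lean`).  Member `W ∈ MemBallZdS a Λ_t t` inside the one-link pair door
`ρ := 6(d−1)|β| e^{a} e^{t} √(cv) + e^{a/2} √c Λ_t < 1`, ANY DLR state `μ`; `u₃(f; g; h) := cov(fg, h) − ⟨f⟩cov(g, h) − ⟨g⟩cov(f, h)`:
* `abs_cov_mul_le_S` — `|cov_μ(fg, h)| ≤ 8N (M_f Σδ_g + M_g Σδ_f)(Σδ_h) e^{−t d(Δ_f ∪ Δ_g, Δ_h)}` (product observable, `isLipBound_mul_restrict`);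
* ★ `abs_threePoint_le_split_S` — ONE SPLIT (`h` isolated): `|u₃(f; g; h)| ≤ 16N (M_f Σδ_g + M_g Σδ_f)(Σδ_h) e^{−t d(Δ_f ∪ Δ_g, Δ_h)}`;
* ★★ `abs_threePoint_le_tree_S` — TREE DECAY: `B₃ := (M_fΣδ_g + M_gΣδ_f)Σδ_h + (M_fΣδ_h + M_hΣδ_f)Σδ_g + (M_gΣδ_h + M_hΣδ_g)Σδ_f`, `s = t/3`:
  `|u₃(f; g; h)| ≤ 16N B₃ (e^{−s d(Δ_f,Δ_h)} + e^{−s d(Δ_g,Δ_h)})(e^{−s d(Δ_f,Δ_g)} + e^{−s d(Δ_h,Δ_g)})(e^{−s d(Δ_g,Δ_f)} + e^{−s d(Δ_h,Δ_f)})` — three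
  Dobrushin splits (`threePoint_swap`/`threePoint_rotate` of ds-1's cumulant algebra), the best decaying in the largest union-distance, hence in their
  mean; every monomial of the product is a TREE exponential through the three supports.  Per-term input of the second-order susceptibility
  `Σ_{X,Y} u₃(F; V_X; V_Y)` and of `C²` along the lines of the ball (successor files);
* `su2_abs_threePoint_le_tree_dim4` — `SU(2)`, `ℤ⁴`, hypothesis-free on `MemBallZdS a Λ t` (`6|β_W| e^{a} e^{t} + e^{a/2} √(2/3) Λ < 1`).
WHAT THIS IS NOT: sharp for large supports (the three set distances can all vanish); lattice strong coupling; nothing continuum / Clay.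
-/

noncomputable section

open MeasureTheory Function Finset ProbabilityTheory Real
open scoped NNReal
open Literature.Probability.LatticeModels
open Literature.Probability.LatticeModels.DobrushinMetric
open Literature.MathematicalPhysics.QuantumLattice
open Literature.MathematicalPhysics.QuantumFieldTheory hiding ZdEdge
open Summit.QuantumFields.BalabanUV.InfraRed.StrongCouplingPoincareDoorSUN (oneLinkPoincareSUN_two_sharp)
open Summit.Ventures.YMGap.CouplingResponse (abs_threePoint_le threePoint_swap threePoint_rotate exp_neg_mul_min_le)

namespace Summit.Ventures.YMGap.RobustBall

variable {d N : ℕ}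

/-! ### Geometry of the set distance of a union -/

/-- `d(A ∪ B, C) ≤ d(B, C)` for nonempty `B`, `C`. -/
theorem setDistEdges_union_le_right (A : Finset (ZdEdge d)) {B C : Finset (ZdEdge d)} (hB : B.Nonempty) (hC : C.Nonempty) :
    setDistEdges (A ∪ B) C ≤ setDistEdges B C := by
  obtain ⟨u, hu, v, hv, heq⟩ := exists_setDistEdges_eq hB hC
  rw [heq]
  exact setDistEdges_le_norm_sub (Finset.mem_union_right A hu) hv

/-- `d(A ∪ B, C) ≤ d(A, C)` for nonempty `A`, `C`. -/
theorem setDistEdges_union_le_left {A C : Finset (ZdEdge d)} (B : Finset (ZdEdge d)) (hA : A.Nonempty) (hC : C.Nonempty) :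
    setDistEdges (A ∪ B) C ≤ setDistEdges A C := by rw [Finset.union_comm]; exact setDistEdges_union_le_right B hA hC

/-- `min(d(A, C), d(B, C)) ≤ d(A ∪ B, C)` (with the junk value `0` for empty sets on both sides). -/
theorem min_setDistEdges_le_union (A B C : Finset (ZdEdge d)) :
    min (setDistEdges A C) (setDistEdges B C) ≤ setDistEdges (A ∪ B) C := by
  by_cases hC : C.Nonempty
  · by_cases hAB : (A ∪ B).Nonempty
    · obtain ⟨u, hu, v, hv, heq⟩ := exists_setDistEdges_eq hAB hC
      rw [heq]
      rcases Finset.mem_union.1 hu with huA | huB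
      · exact (min_le_left _ _).trans (setDistEdges_le_norm_sub huA hv)
      · exact (min_le_right _ _).trans (setDistEdges_le_norm_sub huB hv)
    · have hA : A = ∅ := Finset.union_eq_empty.1 (Finset.not_nonempty_iff_eq_empty.1 hAB) |>.1
      have h0 : setDistEdges A C = 0 := by
        rw [setDistEdges, dif_neg]; rw [hA]; simp
      exact (min_le_left _ _).trans (h0.le.trans (setDistEdges_nonneg _ _))
  · rw [setDistEdges_of_not_nonempty hC, setDistEdges_of_not_nonempty hC, setDistEdges_of_not_nonempty hC, min_self]

/-- `e^{−s d(A∪B, C)} ≤ e^{−s d(A, C)} + e^{−s d(B, C)}` for `s ≥ 0`. -/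
theorem exp_neg_setDistEdges_union_le {s : ℝ} (hs : 0 ≤ s) (A B C : Finset (ZdEdge d)) :
    exp (-(s * setDistEdges (A ∪ B) C)) ≤ exp (-(s * setDistEdges A C)) + exp (-(s * setDistEdges B C)) :=
  (exp_le_exp.2 (by nlinarith [min_setDistEdges_le_union A B C])).trans exp_neg_mul_min_le

/-! ### Products of local Lipschitz observables -/

section Product

variable {S : Type*} {f g : (ZdEdge d → S) → ℝ} {Δf Δg : Finset (ZdEdge d)} {Mf Mg : ℝ} {δf δg : ZdEdge d → ℝ}
  {r : S → S → ℝ}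

/-- **Lipschitz vector of a product**, restricted to the supports: `|f| ≤ M_f` on `Δ_f` with vector `δ_f`, `|g| ≤ M_g` on `Δ_g` with `δ_g`, `r ≥ 0`
⇒ `fg` has vector `y ↦ M_f·𝟙_{Δ_g}(y)δ_g(y) + M_g·𝟙_{Δ_f}(y)δ_f(y)`. -/
theorem isLipBound_mul_restrict [DecidableEq (ZdEdge d)] (hr : ∀ a b, 0 ≤ r a b) (hfdep : DependsOn f (↑Δf : Set (ZdEdge d)))
    (hgdep : DependsOn g (↑Δg : Set (ZdEdge d))) (hMf : ∀ σ, |f σ| ≤ Mf) (hMg : ∀ σ, |g σ| ≤ Mg) (hMf0 : 0 ≤ Mf) (hMg0 : 0 ≤ Mg)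
    (hδf : IsLipBound r f δf) (hδg : IsLipBound r g δg) :
    IsLipBound r (fun σ => f σ * g σ) (fun y => Mf * (if y ∈ Δg then δg y else 0) + Mg * (if y ∈ Δf then δf y else 0)) := by
  have hf' := hδf.restrict hfdep
  have hg' := hδg.restrict hgdep
  refine ⟨fun y => add_nonneg (mul_nonneg hMf0 (hg'.nonneg y)) (mul_nonneg hMg0 (hf'.nonneg y)), fun y σ τ hστ => ?_⟩
  have h1 : |f σ| * |g σ - g τ| ≤ Mf * ((if y ∈ Δg then δg y else 0) * r (σ y) (τ y)) :=
    (mul_le_mul_of_nonneg_left (hg'.le y σ τ hστ) (abs_nonneg _)).trans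
      (mul_le_mul_of_nonneg_right (hMf σ) (mul_nonneg (hg'.nonneg y) (hr _ _)))
  have h2 : |f σ - f τ| * |g τ| ≤ (if y ∈ Δf then δf y else 0) * r (σ y) (τ y) * Mg :=
    (mul_le_mul_of_nonneg_left (hMg τ) (abs_nonneg _)).trans (mul_le_mul_of_nonneg_right (hf'.le y σ τ hστ) hMg0)
  calc |f σ * g σ - f τ * g τ| = |f σ * (g σ - g τ) + (f σ - f τ) * g τ| := by ring_nf
    _ ≤ |f σ * (g σ - g τ)| + |(f σ - f τ) * g τ| := abs_add_le _ _
    _ = |f σ| * |g σ - g τ| + |f σ - f τ| * |g τ| := by rw [abs_mul, abs_mul]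
    _ ≤ _ := add_le_add h1 h2
    _ = _ := by ring

/-- The total mass of the product vector on `Δ_f ∪ Δ_g` is `M_f Σ_{Δ_g} δ_g + M_g Σ_{Δ_f} δ_f`. -/
theorem sum_union_mul_restrict [DecidableEq (ZdEdge d)] (Δf Δg : Finset (ZdEdge d)) (Mf Mg : ℝ) (δf δg : ZdEdge d → ℝ) :
    ∑ y ∈ Δf ∪ Δg, (Mf * (if y ∈ Δg then δg y else 0) + Mg * (if y ∈ Δf then δf y else 0)) =
      Mf * ∑ y ∈ Δg, δg y + Mg * ∑ y ∈ Δf, δf y := by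
  rw [sum_add_distrib, ← mul_sum, ← mul_sum, Finset.sum_ite_mem, Finset.sum_ite_mem, Finset.union_inter_cancel_right,
    Finset.union_inter_cancel_left]

/-- A product of functions depending on `Δ_f`, `Δ_g` depends on `Δ_f ∪ Δ_g`. -/
theorem dependsOn_mul_union' [DecidableEq (ZdEdge d)] (hfdep : DependsOn f (↑Δf : Set (ZdEdge d)))
    (hgdep : DependsOn g (↑Δg : Set (ZdEdge d))) : DependsOn (fun σ => f σ * g σ) (↑(Δf ∪ Δg) : Set (ZdEdge d)) := fun σ τ h => by
  show f σ * g σ = f τ * g τ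
  rw [hfdep (fun y hy => h y (by simp [Finset.mem_coe.1 hy])), hgdep (fun y hy => h y (by simp [Finset.mem_coe.1 hy]))]

end Product

/-! ### The third cumulant on the ball -/

section SUN

variable {W : Potential (ZdEdge d) (Matrix.specialUnitaryGroup (Fin N) ℂ)}

/-- **The pair door's covariance bound for a product observable**: `|cov_μ(fg, h)| ≤ 8N (M_f Σδ_g + M_g Σδ_f)(Σδ_h) e^{−t d(Δ_f ∪ Δ_g, Δ_h)}`. -/
theorem abs_cov_mul_le_S (hd : 1 ≤ d) (hN : 1 ≤ N) {β b c v a Λt t : ℝ}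
    (hc : 0 ≤ c) (hv : 0 ≤ v) (hb : |β| * (2 * ((d : ℝ) - 1)) ≤ b)
    (hP : ∀ B : Matrix (Fin N) (Fin N) ℂ, matrixOpNorm B ≤ b →
      ∀ (ψ : Matrix.specialUnitaryGroup (Fin N) ℂ → ℝ) (M : ℝ), 0 ≤ M →
        (∀ x y, |ψ x - ψ y| ≤ M * suFrobDist x y) →
        Var[ψ; (haarProbability (Matrix.specialUnitaryGroup (Fin N) ℂ)).tilted
          fun g => (N : ℝ) * ((g : Matrix (Fin N) (Fin N) ℂ) * B).trace.re] ≤ c * M ^ 2)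
    (hVB : ∀ B : Matrix (Fin N) (Fin N) ℂ, matrixOpNorm B ≤ b → ∀ Δ : Matrix (Fin N) (Fin N) ℂ,
      Var[fun g : Matrix.specialUnitaryGroup (Fin N) ℂ =>
          (N : ℝ) * ((g : Matrix (Fin N) (Fin N) ℂ) * Δ).trace.re;
        (haarProbability (Matrix.specialUnitaryGroup (Fin N) ℂ)).tilted
          fun g => (N : ℝ) * ((g : Matrix (Fin N) (Fin N) ℂ) * B).trace.re] ≤ v * frobNorm Δ ^ 2)
    (ht : 0 ≤ t) (hρ : 6 * ((d : ℝ) - 1) * |β| * (exp a * exp t * Real.sqrt (c * v)) + exp (a / 2) * Real.sqrt c * Λt < 1)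
    (hW : MemBallZdS a Λt t W) {μ : Measure (LGConfig d (Matrix.specialUnitaryGroup (Fin N) ℂ))}
    (hμ : μ ∈ perturbedGibbsMeasuresS (d := d) (fundamentalRep (Fin N)) (N * β) W)
    {f : LGConfig d (Matrix.specialUnitaryGroup (Fin N) ℂ) → ℝ} (hfm : Measurable f) {Δf : Finset (ZdEdge d)}
    (hfdep : DependsOn f (↑Δf : Set (ZdEdge d))) {Mf : ℝ} (hMf : ∀ σ, |f σ| ≤ Mf) {δf : ZdEdge d → ℝ} (hδf : IsLipBound suFrobDist f δf)
    {g : LGConfig d (Matrix.specialUnitaryGroup (Fin N) ℂ) → ℝ} (hgm : Measurable g) {Δg : Finset (ZdEdge d)}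
    (hgdep : DependsOn g (↑Δg : Set (ZdEdge d))) {Mg : ℝ} (hMg : ∀ σ, |g σ| ≤ Mg) {δg : ZdEdge d → ℝ} (hδg : IsLipBound suFrobDist g δg)
    {h : LGConfig d (Matrix.specialUnitaryGroup (Fin N) ℂ) → ℝ} (hhm : Measurable h) {Δh : Finset (ZdEdge d)}
    (hhdep : DependsOn h (↑Δh : Set (ZdEdge d))) {Mh : ℝ} (hMh : ∀ σ, |h σ| ≤ Mh) {δh : ZdEdge d → ℝ} (hδh : IsLipBound suFrobDist h δh) :
    |cov[fun σ => f σ * g σ, h; μ]| ≤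
      8 * N * (Mf * ∑ y ∈ Δg, δg y + Mg * ∑ y ∈ Δf, δf y) * (∑ y ∈ Δh, δh y) * exp (-(t * setDistEdges (Δf ∪ Δg) Δh)) := by
  classical
  obtain ⟨BW, hBW⟩ := hW.summable
  obtain ⟨osc, lip, ℓ, hosc, hlip, hoscs, hosca, hlips, hℓ, hℓs, hℓt⟩ := hW.loads
  have hMf0 : 0 ≤ Mf := (abs_nonneg _).trans (hMf 1)
  have hMg0 : 0 ≤ Mg := (abs_nonneg _).trans (hMg 1)
  have hpm : Measurable fun σ => f σ * g σ := hfm.mul hgm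
  have hMp : ∀ σ, |f σ * g σ| ≤ Mf * Mg := fun σ => by rw [abs_mul]; exact mul_le_mul (hMf σ) (hMg σ) (abs_nonneg _) hMf0
  have h1 := abs_cov_le_of_isLipBound_S hd hN hc hv hb hP hVB hBW hW.continuous hW.dependsOn hosc hoscs hosca hlip hlips hℓ ht hℓs hℓt hρ hμ
    hpm (dependsOn_mul_union' hfdep hgdep) hMp
    (isLipBound_mul_restrict (fun _ _ => suFrobDist_nonneg _ _) hfdep hgdep hMf hMg hMf0 hMg0 hδf hδg) hhm hhdep hMh hδh
  have h4N : (2 * Real.sqrt N) ^ 2 = 4 * N := by rw [mul_pow, Real.sq_sqrt (Nat.cast_nonneg N)]; norm_num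
  rw [sum_union_mul_restrict, h4N] at h1
  refine h1.trans (le_of_eq ?_)
  ring

/-- ★ **ONE SPLIT OF THE THIRD CUMULANT ON THE BALL (`h` isolated).**  Under the hypotheses of `abs_cov_mul_le_S`:
`|cov(fg, h) − ⟨f⟩cov(g, h) − ⟨g⟩cov(f, h)| ≤ 16N (M_f Σδ_g + M_g Σδ_f)(Σδ_h) e^{−t d(Δ_f ∪ Δ_g, Δ_h)}`. -/
theorem abs_threePoint_le_split_S (hd : 1 ≤ d) (hN : 1 ≤ N) {β b c v a Λt t : ℝ}
    (hc : 0 ≤ c) (hv : 0 ≤ v) (hb : |β| * (2 * ((d : ℝ) - 1)) ≤ b)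
    (hP : ∀ B : Matrix (Fin N) (Fin N) ℂ, matrixOpNorm B ≤ b →
      ∀ (ψ : Matrix.specialUnitaryGroup (Fin N) ℂ → ℝ) (M : ℝ), 0 ≤ M →
        (∀ x y, |ψ x - ψ y| ≤ M * suFrobDist x y) →
        Var[ψ; (haarProbability (Matrix.specialUnitaryGroup (Fin N) ℂ)).tilted
          fun g => (N : ℝ) * ((g : Matrix (Fin N) (Fin N) ℂ) * B).trace.re] ≤ c * M ^ 2)
    (hVB : ∀ B : Matrix (Fin N) (Fin N) ℂ, matrixOpNorm B ≤ b → ∀ Δ : Matrix (Fin N) (Fin N) ℂ,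
      Var[fun g : Matrix.specialUnitaryGroup (Fin N) ℂ =>
          (N : ℝ) * ((g : Matrix (Fin N) (Fin N) ℂ) * Δ).trace.re;
        (haarProbability (Matrix.specialUnitaryGroup (Fin N) ℂ)).tilted
          fun g => (N : ℝ) * ((g : Matrix (Fin N) (Fin N) ℂ) * B).trace.re] ≤ v * frobNorm Δ ^ 2)
    (ht : 0 ≤ t) (hρ : 6 * ((d : ℝ) - 1) * |β| * (exp a * exp t * Real.sqrt (c * v)) + exp (a / 2) * Real.sqrt c * Λt < 1)
    (hW : MemBallZdS a Λt t W) {μ : Measure (LGConfig d (Matrix.specialUnitaryGroup (Fin N) ℂ))}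
    (hμ : μ ∈ perturbedGibbsMeasuresS (d := d) (fundamentalRep (Fin N)) (N * β) W)
    {f : LGConfig d (Matrix.specialUnitaryGroup (Fin N) ℂ) → ℝ} (hfm : Measurable f) {Δf : Finset (ZdEdge d)}
    (hfdep : DependsOn f (↑Δf : Set (ZdEdge d))) {Mf : ℝ} (hMf : ∀ σ, |f σ| ≤ Mf) {δf : ZdEdge d → ℝ} (hδf : IsLipBound suFrobDist f δf)
    {g : LGConfig d (Matrix.specialUnitaryGroup (Fin N) ℂ) → ℝ} (hgm : Measurable g) {Δg : Finset (ZdEdge d)}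
    (hgdep : DependsOn g (↑Δg : Set (ZdEdge d))) {Mg : ℝ} (hMg : ∀ σ, |g σ| ≤ Mg) {δg : ZdEdge d → ℝ} (hδg : IsLipBound suFrobDist g δg)
    {h : LGConfig d (Matrix.specialUnitaryGroup (Fin N) ℂ) → ℝ} (hhm : Measurable h) {Δh : Finset (ZdEdge d)}
    (hhdep : DependsOn h (↑Δh : Set (ZdEdge d))) {Mh : ℝ} (hMh : ∀ σ, |h σ| ≤ Mh) {δh : ZdEdge d → ℝ} (hδh : IsLipBound suFrobDist h δh) :
    |cov[fun σ => f σ * g σ, h; μ] - (∫ σ, f σ ∂μ) * cov[g, h; μ] - (∫ σ, g σ ∂μ) * cov[f, h; μ]| ≤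
      16 * N * (Mf * ∑ y ∈ Δg, δg y + Mg * ∑ y ∈ Δf, δf y) * (∑ y ∈ Δh, δh y) * exp (-(t * setDistEdges (Δf ∪ Δg) Δh)) := by
  classical
  have hμP : IsGibbsMeasure (perturbedYMS (d := d) (fundamentalRep (Fin N)) (N * β) W) μ := hμ
  haveI := hμP.isProbabilityMeasure
  obtain ⟨BW, hBW⟩ := hW.summable
  obtain ⟨osc, lip, ℓ, hosc, hlip, hoscs, hosca, hlips, hℓ, hℓs, hℓt⟩ := hW.loads
  have hMf0 : 0 ≤ Mf := (abs_nonneg _).trans (hMf 1)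
  have hMg0 : 0 ≤ Mg := (abs_nonneg _).trans (hMg 1)
  have hSf : 0 ≤ ∑ y ∈ Δf, δf y := sum_nonneg fun y _ => hδf.nonneg y
  have hSg : 0 ≤ ∑ y ∈ Δg, δg y := sum_nonneg fun y _ => hδg.nonneg y
  have hSh : 0 ≤ ∑ y ∈ Δh, δh y := sum_nonneg fun y _ => hδh.nonneg y
  have h4N : (2 * Real.sqrt N) ^ 2 = 4 * N := by rw [mul_pow, Real.sq_sqrt (Nat.cast_nonneg N)]; norm_num
  -- the three covariance bounds
  have e1 := abs_cov_mul_le_S hd hN hc hv hb hP hVB ht hρ hW hμ hfm hfdep hMf hδf hgm hgdep hMg hδg hhm hhdep hMh hδh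
  have e2 := abs_cov_le_of_isLipBound_S hd hN hc hv hb hP hVB hBW hW.continuous hW.dependsOn hosc hoscs hosca hlip hlips hℓ ht hℓs hℓt hρ hμ
    hgm hgdep hMg hδg hhm hhdep hMh hδh
  have e3 := abs_cov_le_of_isLipBound_S hd hN hc hv hb hP hVB hBW hW.continuous hW.dependsOn hosc hoscs hosca hlip hlips hℓ ht hℓs hℓt hρ hμ
    hfm hfdep hMf hδf hhm hhdep hMh hδh
  rw [h4N] at e2 e3
  -- the two single-observable distances dominate the union distance (or the bound vanishes)
  obtain ⟨E, hE⟩ : ∃ E : ℝ, E = exp (-(t * setDistEdges (Δf ∪ Δg) Δh)) := ⟨_, rfl⟩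
  rw [← hE] at e1 ⊢
  have hE0 : 0 ≤ E := by rw [hE]; exact (exp_pos _).le
  have e2' : Mf * |cov[g, h; μ]| ≤ Mf * (8 * N * (∑ y ∈ Δg, δg y) * (∑ y ∈ Δh, δh y) * E) := by
    refine mul_le_mul_of_nonneg_left (e2.trans ?_) hMf0
    by_cases hg0 : Δg.Nonempty
    · by_cases hh0 : Δh.Nonempty
      · have hmono : exp (-(t * setDistEdges Δg Δh)) ≤ E := by
          rw [hE]; exact exp_le_exp.2 (by nlinarith [setDistEdges_union_le_right Δf hg0 hh0])
        calc 2 * (4 * (N : ℝ)) * (∑ y ∈ Δh, δh y) * (∑ y ∈ Δg, δg y) * exp (-(t * setDistEdges Δg Δh))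
            ≤ 2 * (4 * (N : ℝ)) * (∑ y ∈ Δh, δh y) * (∑ y ∈ Δg, δg y) * E := by gcongr
          _ = _ := by ring
      · simp [Finset.not_nonempty_iff_eq_empty.1 hh0]
    · simp [Finset.not_nonempty_iff_eq_empty.1 hg0]
  have e3' : Mg * |cov[f, h; μ]| ≤ Mg * (8 * N * (∑ y ∈ Δf, δf y) * (∑ y ∈ Δh, δh y) * E) := by
    refine mul_le_mul_of_nonneg_left (e3.trans ?_) hMg0
    by_cases hf0 : Δf.Nonempty
    · by_cases hh0 : Δh.Nonempty
      · have hmono : exp (-(t * setDistEdges Δf Δh)) ≤ E := by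
          rw [hE]; exact exp_le_exp.2 (by nlinarith [setDistEdges_union_le_left Δg hf0 hh0])
        calc 2 * (4 * (N : ℝ)) * (∑ y ∈ Δh, δh y) * (∑ y ∈ Δf, δf y) * exp (-(t * setDistEdges Δf Δh))
            ≤ 2 * (4 * (N : ℝ)) * (∑ y ∈ Δh, δh y) * (∑ y ∈ Δf, δf y) * E := by gcongr
          _ = _ := by ring
      · simp [Finset.not_nonempty_iff_eq_empty.1 hh0]
    · simp [Finset.not_nonempty_iff_eq_empty.1 hf0]
  calc |cov[fun σ => f σ * g σ, h; μ] - (∫ σ, f σ ∂μ) * cov[g, h; μ] - (∫ σ, g σ ∂μ) * cov[f, h; μ]|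
      ≤ |cov[fun σ => f σ * g σ, h; μ]| + Mf * |cov[g, h; μ]| + Mg * |cov[f, h; μ]| := abs_threePoint_le hMf hMg
    _ ≤ 8 * N * (Mf * ∑ y ∈ Δg, δg y + Mg * ∑ y ∈ Δf, δf y) * (∑ y ∈ Δh, δh y) * E +
          Mf * (8 * N * (∑ y ∈ Δg, δg y) * (∑ y ∈ Δh, δh y) * E) + Mg * (8 * N * (∑ y ∈ Δf, δf y) * (∑ y ∈ Δh, δh y) * E) :=
        add_le_add (add_le_add e1 e2') e3'
    _ = 16 * N * (Mf * ∑ y ∈ Δg, δg y + Mg * ∑ y ∈ Δf, δf y) * (∑ y ∈ Δh, δh y) * E := by ring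

/-- ★★ **TREE DECAY OF THE THIRD CUMULANT, uniformly on the weighted ball.**  Under the hypotheses of `abs_cov_mul_le_S`, with
`B₃ := (M_fΣδ_g + M_gΣδ_f)Σδ_h + (M_fΣδ_h + M_hΣδ_f)Σδ_g + (M_gΣδ_h + M_hΣδ_g)Σδ_f` and `s := t/3`:
`|u₃(f; g; h)| ≤ 16N B₃ · (e^{−s d(Δ_f,Δ_h)} + e^{−s d(Δ_g,Δ_h)}) (e^{−s d(Δ_f,Δ_g)} + e^{−s d(Δ_h,Δ_g)}) (e^{−s d(Δ_g,Δ_f)} + e^{−s d(Δ_h,Δ_f)})`. -/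
theorem abs_threePoint_le_tree_S (hd : 1 ≤ d) (hN : 1 ≤ N) {β b c v a Λt t : ℝ}
    (hc : 0 ≤ c) (hv : 0 ≤ v) (hb : |β| * (2 * ((d : ℝ) - 1)) ≤ b)
    (hP : ∀ B : Matrix (Fin N) (Fin N) ℂ, matrixOpNorm B ≤ b →
      ∀ (ψ : Matrix.specialUnitaryGroup (Fin N) ℂ → ℝ) (M : ℝ), 0 ≤ M →
        (∀ x y, |ψ x - ψ y| ≤ M * suFrobDist x y) →
        Var[ψ; (haarProbability (Matrix.specialUnitaryGroup (Fin N) ℂ)).tilted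
          fun g => (N : ℝ) * ((g : Matrix (Fin N) (Fin N) ℂ) * B).trace.re] ≤ c * M ^ 2)
    (hVB : ∀ B : Matrix (Fin N) (Fin N) ℂ, matrixOpNorm B ≤ b → ∀ Δ : Matrix (Fin N) (Fin N) ℂ,
      Var[fun g : Matrix.specialUnitaryGroup (Fin N) ℂ =>
          (N : ℝ) * ((g : Matrix (Fin N) (Fin N) ℂ) * Δ).trace.re;
        (haarProbability (Matrix.specialUnitaryGroup (Fin N) ℂ)).tilted
          fun g => (N : ℝ) * ((g : Matrix (Fin N) (Fin N) ℂ) * B).trace.re] ≤ v * frobNorm Δ ^ 2)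
    (ht : 0 ≤ t) (hρ : 6 * ((d : ℝ) - 1) * |β| * (exp a * exp t * Real.sqrt (c * v)) + exp (a / 2) * Real.sqrt c * Λt < 1)
    (hW : MemBallZdS a Λt t W) {μ : Measure (LGConfig d (Matrix.specialUnitaryGroup (Fin N) ℂ))}
    (hμ : μ ∈ perturbedGibbsMeasuresS (d := d) (fundamentalRep (Fin N)) (N * β) W)
    {f : LGConfig d (Matrix.specialUnitaryGroup (Fin N) ℂ) → ℝ} (hfm : Measurable f) {Δf : Finset (ZdEdge d)}
    (hfdep : DependsOn f (↑Δf : Set (ZdEdge d))) {Mf : ℝ} (hMf : ∀ σ, |f σ| ≤ Mf) {δf : ZdEdge d → ℝ} (hδf : IsLipBound suFrobDist f δf)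
    {g : LGConfig d (Matrix.specialUnitaryGroup (Fin N) ℂ) → ℝ} (hgm : Measurable g) {Δg : Finset (ZdEdge d)}
    (hgdep : DependsOn g (↑Δg : Set (ZdEdge d))) {Mg : ℝ} (hMg : ∀ σ, |g σ| ≤ Mg) {δg : ZdEdge d → ℝ} (hδg : IsLipBound suFrobDist g δg)
    {h : LGConfig d (Matrix.specialUnitaryGroup (Fin N) ℂ) → ℝ} (hhm : Measurable h) {Δh : Finset (ZdEdge d)}
    (hhdep : DependsOn h (↑Δh : Set (ZdEdge d))) {Mh : ℝ} (hMh : ∀ σ, |h σ| ≤ Mh) {δh : ZdEdge d → ℝ} (hδh : IsLipBound suFrobDist h δh) :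
    |cov[fun σ => f σ * g σ, h; μ] - (∫ σ, f σ ∂μ) * cov[g, h; μ] - (∫ σ, g σ ∂μ) * cov[f, h; μ]| ≤
      16 * N * ((Mf * ∑ y ∈ Δg, δg y + Mg * ∑ y ∈ Δf, δf y) * (∑ y ∈ Δh, δh y) +
          (Mf * ∑ y ∈ Δh, δh y + Mh * ∑ y ∈ Δf, δf y) * (∑ y ∈ Δg, δg y) +
          (Mg * ∑ y ∈ Δh, δh y + Mh * ∑ y ∈ Δg, δg y) * (∑ y ∈ Δf, δf y)) *
        ((exp (-(t / 3 * setDistEdges Δf Δh)) + exp (-(t / 3 * setDistEdges Δg Δh))) *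
          (exp (-(t / 3 * setDistEdges Δf Δg)) + exp (-(t / 3 * setDistEdges Δh Δg))) *
          (exp (-(t / 3 * setDistEdges Δg Δf)) + exp (-(t / 3 * setDistEdges Δh Δf)))) := by
  classical
  have hμP : IsGibbsMeasure (perturbedYMS (d := d) (fundamentalRep (Fin N)) (N * β) W) μ := hμ
  haveI := hμP.isProbabilityMeasure
  have hMf0 : 0 ≤ Mf := (abs_nonneg _).trans (hMf 1); have hMg0 : 0 ≤ Mg := (abs_nonneg _).trans (hMg 1)
  have hMh0 : 0 ≤ Mh := (abs_nonneg _).trans (hMh 1)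
  have hSf : 0 ≤ ∑ y ∈ Δf, δf y := sum_nonneg fun y _ => hδf.nonneg y; have hSg : 0 ≤ ∑ y ∈ Δg, δg y := sum_nonneg fun y _ => hδg.nonneg y
  have hSh : 0 ≤ ∑ y ∈ Δh, δh y := sum_nonneg fun y _ => hδh.nonneg y
  obtain ⟨B₁, hB₁⟩ : ∃ x : ℝ, x = (Mf * ∑ y ∈ Δg, δg y + Mg * ∑ y ∈ Δf, δf y) * ∑ y ∈ Δh, δh y := ⟨_, rfl⟩
  obtain ⟨B₂, hB₂⟩ : ∃ x : ℝ, x = (Mf * ∑ y ∈ Δh, δh y + Mh * ∑ y ∈ Δf, δf y) * ∑ y ∈ Δg, δg y := ⟨_, rfl⟩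
  obtain ⟨B₃, hB₃⟩ : ∃ x : ℝ, x = (Mg * ∑ y ∈ Δh, δh y + Mh * ∑ y ∈ Δg, δg y) * ∑ y ∈ Δf, δf y := ⟨_, rfl⟩
  have hB₁0 : 0 ≤ B₁ := by rw [hB₁]; positivity
  have hB₂0 : 0 ≤ B₂ := by rw [hB₂]; positivity
  have hB₃0 : 0 ≤ B₃ := by rw [hB₃]; positivity
  obtain ⟨m₁, hm₁⟩ : ∃ x : ℝ, x = setDistEdges (Δf ∪ Δg) Δh := ⟨_, rfl⟩
  obtain ⟨m₂, hm₂⟩ : ∃ x : ℝ, x = setDistEdges (Δf ∪ Δh) Δg := ⟨_, rfl⟩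
  obtain ⟨m₃, hm₃⟩ : ∃ x : ℝ, x = setDistEdges (Δg ∪ Δh) Δf := ⟨_, rfl⟩
  -- the three splits
  have s1 : |cov[fun σ => f σ * g σ, h; μ] - (∫ σ, f σ ∂μ) * cov[g, h; μ] - (∫ σ, g σ ∂μ) * cov[f, h; μ]| ≤
      16 * N * B₁ * exp (-(t * m₁)) := by
    have h1 := abs_threePoint_le_split_S hd hN hc hv hb hP hVB ht hρ hW hμ hfm hfdep hMf hδf hgm hgdep hMg hδg hhm hhdep hMh hδh
    rw [← hm₁] at h1; rw [hB₁]; linarith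
  have s2 : |cov[fun σ => f σ * g σ, h; μ] - (∫ σ, f σ ∂μ) * cov[g, h; μ] - (∫ σ, g σ ∂μ) * cov[f, h; μ]| ≤
      16 * N * B₂ * exp (-(t * m₂)) := by
    have h1 := abs_threePoint_le_split_S hd hN hc hv hb hP hVB ht hρ hW hμ hfm hfdep hMf hδf hhm hhdep hMh hδh hgm hgdep hMg hδg
    rw [← hm₂, ← threePoint_swap hfm hgm hhm hMf hMg hMh] at h1; rw [hB₂]; linarith
  have s3 : |cov[fun σ => f σ * g σ, h; μ] - (∫ σ, f σ ∂μ) * cov[g, h; μ] - (∫ σ, g σ ∂μ) * cov[f, h; μ]| ≤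
      16 * N * B₃ * exp (-(t * m₃)) := by
    have h1 := abs_threePoint_le_split_S hd hN hc hv hb hP hVB ht hρ hW hμ hgm hgdep hMg hδg hhm hhdep hMh hδh hfm hfdep hMf hδf
    rw [← hm₃, ← threePoint_rotate hfm hgm hhm hMf hMg hMh] at h1; rw [hB₃]; linarith
  -- the best split: the largest of `m₁, m₂, m₃` is at least their mean
  obtain ⟨U, hU⟩ : ∃ x : ℝ, x = |cov[fun σ => f σ * g σ, h; μ] - (∫ σ, f σ ∂μ) * cov[g, h; μ] - (∫ σ, g σ ∂μ) * cov[f, h; μ]| :=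
    ⟨_, rfl⟩
  rw [← hU] at s1 s2 s3 ⊢
  obtain ⟨Bt, hBt⟩ : ∃ x : ℝ, x = B₁ + B₂ + B₃ := ⟨_, rfl⟩
  have hN0 : (0 : ℝ) ≤ 16 * N := by positivity
  have hBt0 : 0 ≤ Bt := by rw [hBt]; positivity
  have key : ∀ {B m : ℝ}, B ≤ Bt → U ≤ 16 * N * B * exp (-(t * m)) → m₁ + m₂ + m₃ ≤ 3 * m →
      U ≤ 16 * N * Bt * exp (-(t / 3 * (m₁ + m₂ + m₃))) := by
    intro B m hB hUB hm
    have h1 : exp (-(t * m)) ≤ exp (-(t / 3 * (m₁ + m₂ + m₃))) := by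
      refine exp_le_exp.2 ?_
      have := mul_le_mul_of_nonneg_left hm ht
      linarith
    calc U ≤ 16 * N * B * exp (-(t * m)) := hUB
      _ ≤ 16 * N * Bt * exp (-(t / 3 * (m₁ + m₂ + m₃))) :=
          mul_le_mul (mul_le_mul_of_nonneg_left hB hN0) h1 (exp_pos _).le (mul_nonneg hN0 hBt0)
  have hmean : U ≤ 16 * N * Bt * exp (-(t / 3 * (m₁ + m₂ + m₃))) := by
    by_cases h1 : m₁ + m₂ + m₃ ≤ 3 * m₁
    · exact key (by rw [hBt]; linarith) s1 h1
    · by_cases h2 : m₁ + m₂ + m₃ ≤ 3 * m₂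
      · exact key (by rw [hBt]; linarith) s2 h2
      · exact key (by rw [hBt]; linarith) s3 (by rw [not_le] at h1 h2; linarith)
  -- each union distance dominates the minimum of two single distances
  have ht3 : 0 ≤ t / 3 := by positivity
  have f1 : exp (-(t / 3 * m₁)) ≤ exp (-(t / 3 * setDistEdges Δf Δh)) + exp (-(t / 3 * setDistEdges Δg Δh)) :=
    hm₁ ▸ exp_neg_setDistEdges_union_le ht3 Δf Δg Δh
  have f2 : exp (-(t / 3 * m₂)) ≤ exp (-(t / 3 * setDistEdges Δf Δg)) + exp (-(t / 3 * setDistEdges Δh Δg)) :=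
    hm₂ ▸ exp_neg_setDistEdges_union_le ht3 Δf Δh Δg
  have f3 : exp (-(t / 3 * m₃)) ≤ exp (-(t / 3 * setDistEdges Δg Δf)) + exp (-(t / 3 * setDistEdges Δh Δf)) :=
    hm₃ ▸ exp_neg_setDistEdges_union_le ht3 Δg Δh Δf
  have hsplit : exp (-(t / 3 * (m₁ + m₂ + m₃))) = exp (-(t / 3 * m₁)) * exp (-(t / 3 * m₂)) * exp (-(t / 3 * m₃)) := by
    rw [← Real.exp_add, ← Real.exp_add]; congr 1; ring
  have g1 := (exp_pos (-(t / 3 * m₁))).le; have g2 := (exp_pos (-(t / 3 * m₂))).le; have g3 := (exp_pos (-(t / 3 * m₃))).le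
  have hprod : exp (-(t / 3 * m₁)) * exp (-(t / 3 * m₂)) * exp (-(t / 3 * m₃)) ≤
      (exp (-(t / 3 * setDistEdges Δf Δh)) + exp (-(t / 3 * setDistEdges Δg Δh))) *
        (exp (-(t / 3 * setDistEdges Δf Δg)) + exp (-(t / 3 * setDistEdges Δh Δg))) *
        (exp (-(t / 3 * setDistEdges Δg Δf)) + exp (-(t / 3 * setDistEdges Δh Δf))) :=
    mul_le_mul (mul_le_mul f1 f2 g2 (g1.trans f1)) f3 g3 (mul_nonneg (g1.trans f1) (g2.trans f2))
  calc U ≤ 16 * N * Bt * exp (-(t / 3 * (m₁ + m₂ + m₃))) := hmean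
    _ = 16 * N * Bt * (exp (-(t / 3 * m₁)) * exp (-(t / 3 * m₂)) * exp (-(t / 3 * m₃))) := by rw [hsplit]
    _ ≤ 16 * N * Bt * ((exp (-(t / 3 * setDistEdges Δf Δh)) + exp (-(t / 3 * setDistEdges Δg Δh))) *
        (exp (-(t / 3 * setDistEdges Δf Δg)) + exp (-(t / 3 * setDistEdges Δh Δg))) *
        (exp (-(t / 3 * setDistEdges Δg Δf)) + exp (-(t / 3 * setDistEdges Δh Δf)))) :=
        mul_le_mul_of_nonneg_left hprod (mul_nonneg hN0 hBt0)
    _ = _ := by rw [hBt, hB₁, hB₂, hB₃]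

end SUN

/-! ### `SU(2)`, `ℤ⁴`, hypothesis-free -/

/-- **`SU(2)`, `ℤ⁴` — TREE DECAY OF THE THIRD CUMULANT OF LIPSCHITZ CYLINDERS, uniformly on `MemBallZdS a Λ t`** (`0 ≤ t`,
`6|β_W| e^{a} e^{t} + e^{a/2} √(2/3) Λ < 1`, bare coupling `β_W/2`, EVERY DLR `μ`, cylinders `F, G, H` bounded by `M_F, M_G, M_H`; constant `32 B₃`). -/
theorem su2_abs_threePoint_le_tree_dim4 {βW a Λ t : ℝ} (ht : 0 ≤ t)
    (hρ : 6 * |βW| * (exp a * exp t) + exp (a / 2) * Real.sqrt (2 / 3) * Λ < 1)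
    {W : Potential (ZdEdge 4) (Matrix.specialUnitaryGroup (Fin 2) ℂ)} (hW : MemBallZdS a Λ t W)
    {μ : Measure (LGConfig 4 (Matrix.specialUnitaryGroup (Fin 2) ℂ))}
    (hμ : μ ∈ perturbedGibbsMeasuresS (d := 4) (fundamentalRep (Fin 2)) (2 * (βW / 4)) W)
    {F : LGConfig 4 (Matrix.specialUnitaryGroup (Fin 2) ℂ) → ℝ} {ΛF : Finset (ZdEdge 4)} {KF : ℝ≥0}
    (hF : IsLipschitzCylinder (fundamentalRep (Fin 2)) F ΛF KF) {MF : ℝ} (hMF : ∀ σ, |F σ| ≤ MF)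
    {G : LGConfig 4 (Matrix.specialUnitaryGroup (Fin 2) ℂ) → ℝ} {ΛG : Finset (ZdEdge 4)} {KG : ℝ≥0}
    (hG : IsLipschitzCylinder (fundamentalRep (Fin 2)) G ΛG KG) {MG : ℝ} (hMG : ∀ σ, |G σ| ≤ MG)
    {H : LGConfig 4 (Matrix.specialUnitaryGroup (Fin 2) ℂ) → ℝ} {ΛH : Finset (ZdEdge 4)} {KH : ℝ≥0}
    (hH : IsLipschitzCylinder (fundamentalRep (Fin 2)) H ΛH KH) {MH : ℝ} (hMH : ∀ σ, |H σ| ≤ MH) :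
    |cov[fun σ => F σ * G σ, H; μ] - (∫ σ, F σ ∂μ) * cov[G, H; μ] - (∫ σ, G σ ∂μ) * cov[F, H; μ]| ≤
      32 * ((MF * (ΛG.card * KG) + MG * (ΛF.card * KF)) * (ΛH.card * KH) +
          (MF * (ΛH.card * KH) + MH * (ΛF.card * KF)) * (ΛG.card * KG) +
          (MG * (ΛH.card * KH) + MH * (ΛG.card * KG)) * (ΛF.card * KF)) *
        ((exp (-(t / 3 * setDistEdges ΛF ΛH)) + exp (-(t / 3 * setDistEdges ΛG ΛH))) *
          (exp (-(t / 3 * setDistEdges ΛF ΛG)) + exp (-(t / 3 * setDistEdges ΛH ΛG))) *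
          (exp (-(t / 3 * setDistEdges ΛG ΛF)) + exp (-(t / 3 * setDistEdges ΛH ΛF)))) := by
  classical
  have hc : (0 : ℝ) ≤ 2 / 3 := by norm_num
  have hP : ∀ B : Matrix (Fin 2) (Fin 2) ℂ, matrixOpNorm B ≤ |βW / 4| * (2 * (((4 : ℕ) : ℝ) - 1)) →
      ∀ (ψ : Matrix.specialUnitaryGroup (Fin 2) ℂ → ℝ) (M : ℝ), 0 ≤ M →
        (∀ x y, |ψ x - ψ y| ≤ M * suFrobDist x y) →
        Var[ψ; (haarProbability (Matrix.specialUnitaryGroup (Fin 2) ℂ)).tilted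
          fun g => ((2 : ℕ) : ℝ) * ((g : Matrix (Fin 2) (Fin 2) ℂ) * B).trace.re] ≤ 2 / 3 * M ^ 2 :=
    fun B hB ψ M hM hψ => oneLinkPoincareSUN_two_sharp _ B hB ψ M hM hψ
  have hVB := linVariance_of_poincare (N := 2) hP
  have hv : (0 : ℝ) ≤ 2 / 3 * ((2 : ℕ) : ℝ) ^ 2 := by norm_num
  have hsq : Real.sqrt (2 / 3 * (2 / 3 * ((2 : ℕ) : ℝ) ^ 2)) = 4 / 3 := by
    rw [show (2 / 3 * (2 / 3 * ((2 : ℕ) : ℝ) ^ 2) : ℝ) = (4 / 3) ^ 2 by norm_num, Real.sqrt_sq (by norm_num)]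
  have hρ' : 6 * (((4 : ℕ) : ℝ) - 1) * |βW / 4| * (exp a * exp t * Real.sqrt (2 / 3 * (2 / 3 * ((2 : ℕ) : ℝ) ^ 2))) +
      exp (a / 2) * Real.sqrt (2 / 3) * Λ < 1 := by
    rw [hsq, abs_div, abs_of_pos (by norm_num : (0 : ℝ) < 4)]
    have : 6 * (((4 : ℕ) : ℝ) - 1) * (|βW| / 4) * (exp a * exp t * (4 / 3)) = 6 * |βW| * (exp a * exp t) := by norm_num; ring
    rw [this]; exact hρ
  have hμ' : μ ∈ perturbedGibbsMeasuresS (d := 4) (fundamentalRep (Fin 2)) ((2 : ℕ) * (βW / 4)) W := by simpa using hμ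
  have hA : ∀ a b : Matrix.specialUnitaryGroup (Fin 2) ℂ, dist (suEntries a) (suEntries b) ≤ 1 * suFrobDist a b :=
    fun a b => by rw [one_mul]; exact dist_suEntries_le_suFrobDist a b
  have key := abs_threePoint_le_tree_S (N := 2) (d := 4) (by norm_num) (by norm_num) hc hv le_rfl hP hVB ht hρ' hW hμ' hF.measurable
    hF.dependsOn hMF (hF.isLipBound zero_le_one hA) hG.measurable hG.dependsOn hMG (hG.isLipBound zero_le_one hA) hH.measurable hH.dependsOn
    hMH (hH.isLipBound zero_le_one hA)
  have hsum : ∀ (Λ₀ : Finset (ZdEdge 4)) (K : ℝ≥0), ∑ y ∈ Λ₀, (if y ∈ Λ₀ then (1 : ℝ) * (K : ℝ) else 0) = Λ₀.card * K := fun Λ₀ K => by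
    rw [Finset.sum_congr rfl fun y hy => by rw [if_pos hy, one_mul], Finset.sum_const, nsmul_eq_mul]
  rw [hsum, hsum, hsum] at key
  refine key.trans (le_of_eq ?_)
  norm_num

end Summit.Ventures.YMGap.RobustBall

end
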